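import Summits.Ventures.PackingBounds.SphericalCodes.DimFourQuarter
import Summits.Ventures.PackingBounds.Configurations.Dim4Card12Quarter

/-!
# `A(4, arccos 1/4) = 12` — two-sided in the kernel (packaging)

Framing: lottery ticket; floor = certified bounds/negative ranges. Upper side `code_dim4_quarter_le_12` (pub-packcert-lp, certified
Delsarte LP, degree 7, 12.64 ⇒ 12); lower side `Config.Dim4Card12Quarter.exists_code_12` (pub-packcert-recog §26: the 12-point optimum of
S³, rational Gram, tight at exactly 1/4; p373277). No novelty claim: the upper bound `A(4, 1/4) ≤ 12` is in print as a consequence of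
Boyvalenkov–Danev–Bumova 1996 (Cor. 4.5 (a) with Ex. 6.3: `A(4, 1/4) < L₃(4, 1/4) = 13`), and a 12-point configuration of S³ at
angle `arccos(1/4) = 75.522…°` is the putative optimum of the Hardin–Sloane–Smith tables; this file only records that both sides are
now kernel theorems. Tammes form: among any 13 unit vectors of `ℝ⁴` two distinct ones make an angle `< arccos(1/4)`.
-/

namespace Summit.Ventures.PackingBounds.SphericalCodes

/-- **`A(4, arccos 1/4) = 12`**: there is a 12-point code of `ℝ⁴` at cosine `≤ 1/4`, and every such code has at most 12 points. -/
theorem code_dim4_quarter_eq_12 :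
    (∃ C : Finset (EuclideanSpace ℝ (Fin 4)), C.card = 12 ∧ (∀ x ∈ C, ‖x‖ = 1) ∧
        ∀ x ∈ C, ∀ y ∈ C, x ≠ y → inner ℝ x y ≤ 1 / 4) ∧
      ∀ C : Finset (EuclideanSpace ℝ (Fin 4)), (∀ x ∈ C, ‖x‖ = 1) →
        (∀ x ∈ C, ∀ y ∈ C, x ≠ y → inner ℝ x y ≤ 1 / 4) → C.card ≤ 12 :=
  ⟨Config.Dim4Card12Quarter.exists_code_12, code_dim4_quarter_le_12⟩

/-- **Tammes form** (the 13-point problem on `S³`): among any `13` unit vectors of `ℝ⁴`, two distinct ones have inner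
product `> 1/4`, i.e. make an angle `< arccos(1/4) = 75.522…°`. -/
theorem exists_inner_gt_quarter_of_card_eq_13 (C : Finset (EuclideanSpace ℝ (Fin 4)))
    (h1 : ∀ x ∈ C, ‖x‖ = 1) (hC : C.card = 13) :
    ∃ x ∈ C, ∃ y ∈ C, x ≠ y ∧ (1 / 4 : ℝ) < inner ℝ x y := by
  by_contra h
  push Not at h
  have h12 := code_dim4_quarter_le_12 C h1 (fun x hx y hy hxy => h x hx y hy hxy)
  omega

end Summit.Ventures.PackingBounds.SphericalCodes
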